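import Summits.QuantumFields.BalabanUV.Beta.RemainderExplicitHistoryDiagonalMonotone
import Summits.QuantumFields.BalabanUV.Beta.RemainderExplicitHistoryHalfMoment

/-!
# RemainderExplicitHistoryDiagonalWeights — ROAD P3, STATION S-d4p3-g48-1, FIRST FILE: the scalar and combinatorial WEIGHTS behind the
# two-sided law for the cutoff discrepancy of the continuum coupling — coupling gaps both ways from recursion-variable gaps
# (`x − x' ≶ x·min(1, L·x²)` up to constants), the cubic conversion weight, the asymptotic-freedom weight sum `Σ_{s≥1} a_s^{−3∕2} ≤ 2γ∕b`,
# the position-major ↔ age-major re-indexing of an extra-history source, and the two WINDOW SUMS `≍ min(a,K)²∕(K√K)`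

Cell `pub-balaban`, β-function sub-cell, BINDER row D4 «RemainderConst leaves for Bałaban's split» (`HOME/BINDER-OWNERS.md`; owner
lineage `b2b-balaban-beta-an4`; this file by co-owner #3 lineage `b2b-balaban-beta-d4-p3`, road P3 «the reduction road», generation 48,
station S-d4p3-g48-1 «the cutoff discrepancy of the continuum coupling: two-sided law», first file; imports the ninth file of S-d4p3-g47-1
`RemainderExplicitHistoryDiagonalMonotone` (for the chain) and generation 43's `RemainderExplicitHistoryHalfMoment` (for `mul_min_mono` BY
NAME)), β-FLOW TEAM duty (1);
FREEZE (0) honoured (def-free module in road P3's own `RemainderExplicit*` series; no leaf, no interface, no Literature file).  SOURCE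
OF THE SHAPES ONLY: [Balaban1987RG1] (0.20) p. 256, (0.31) and Thm 2 p. 259, §5 p. 298.  Pure real analysis.

HONEST FRAMING (page 1 of everything the β sub-cell writes).  *"Discharging BetaPertH makes Bałaban's UV stability UNCONDITIONAL —
a real constructive-QFT result; it is NOT the continuum limit and NOT the Clay problem."*  THIS FILE DISCHARGES NOTHING OF THE
KIND.  It is [folklore] real analysis about ONE explicit toy family (ours), road P3's ORDER-0 PROFILE FAMILY
`β_{k+1} = b + Σ_{i≤k} ρ(k−i)·min(g_k, |g_k − g_i|)` (generation 44), whose memory PROFILE `ρ ≥ 0` is merely summable (`Σ_{a<N} ρ_a ≤ W`).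
Nothing of Bałaban's (1.22) is asserted or constructed; row D4 class UNCHANGED (critical-path width 0; instance 0∕1; D4 DISCHARGE NO
DATE); NOT B12 Thm 2, NOT BetaPertH, NOT continuum, NOT Clay.  HONEST DEPENDENCY: continuum YM on T⁴ ⇐ BetaPertH ∧ nine spine
estimates (0/9 proved); BetaPertH ⇐ (D1) ∧ (D4) ∧ CAP+tail; G-an2-4 gates asym, D1 and NE2/3/4.  ABSOLUTE RULE: nothing is cited as a
fact.  All letters NOT-IN-PRINT; `BetaFlowAsPrinted S` records a Markov β_n only ⇒ no junction of the as-printed interface changes.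

THE STATION'S QUESTION (generation 47's census, `RemainderExplicitHistoryDiagonalMonotone.hasSum_disc`): for a pinned family of runs the
diagonal discrepancy series has sum `Q(m) := astar g m − invSq g m 0` (continuum recursion variable `m` scales above the pin MINUS the
ultraviolet end of the run with exactly `m` steps); WHEN is `sup_m Q(m) < ∞`?  Generation 47 conjectured «iff `Σ_a a·ρ(a) < ∞`» from numerics.
THE STATION'S ANSWER: `Q(m) ≍ m^{−3∕2}·Σ_a ρ(a)·min(a,m)²` (two-sided — the lower side for the running maximum `max_{m′≤m} Q(m′)` —
with constants in `b, γ, W, g_IR`; the upper side under `Wγ < b`), so `sup_m Q(m) < ∞` iff `Σ_a ρ(a)·min(a,m)² = O(m^{3∕2})`; a bounded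
HALF moment `Σ_a ρ(a)√a` suffices (the first moment is not needed and even gives decay `O(m^{−1∕2})`); for `ρ(a) ≍ a^{−p}` the criterion
reads `p ≥ 3∕2` (kernel text: the borderline `p = 3∕2` and a sparse violating profile in the annex `…DiagonalExamples`, `p > 3∕2` through
the half moment) — the conjectured first-moment threshold `p > 2` is not the true one.

WHAT IS PROVED HERE ([folklore]; 0 sorry; 0 `def`; no β-function appears except in §2's run-level weight).
* §1 `le_of_one_div_sq_le`; **`gap_le_cube_mul`** (`0 < B ≤ A` ⟹ `A − B ≤ (A³∕2)·(1∕B² − 1∕A²)`); **`gap_le_mul_min`** (`1∕x'² ≤ 1∕x² + L` ⟹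
  `x − x' ≤ x·min(1, Lx²∕2)`); **`mul_min_le_gap`** (`1∕x² + L ≤ 1∕x'²` ⟹ `(x∕8)·min(1, Lx²) ≤ x − x'`).
* §2 `cube_le_weight` (`(g_i)³ ≤ a_{K−i}^{−3∕2}` on a box run with a floor, `a_m = 1∕γ² + b·m`), **`sum_weights_lt_le`** (`Σ_{i<K} a_{K−i}^{−3∕2} ≤ 2γ∕b`,
  `T4CouplingMatching.inv_cube_le_telescope` telescoped; no `γ³` term since the pin is excluded).
* §3 **`sum_extra_ages_swap`** (`Σ_{j<K} Σ_{i<n} F (j+n−i) j = Σ_{a<K+n} Σ_{j<K, j+1≤a≤j+n} F a j`), `filter_extra_subset` ∕ `filter_extra_eq` (those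
  positions are among ∕ are exactly the first `min(a,K)` when `a ≤ n`), `sum_inv_sqrt_rev_le`, **`window_upper_le`**
  (`Σ_{j<min(a,K)} (b(K−j))^{−1∕2}·min(1, κa∕(2(K−j))) ≤ 8κ·min(a,K)²∕(K√(bK))`), **`le_window_lower`**
  (`min(a,K)²∕(κ₂K√(b₂K)) ≤ Σ_{j<min(a,K)} (b₂(K−j))^{−1∕2}·min(1, a∕(κ₂(K−j)))`).
-/

noncomputable section

open Finset

namespace Summit.QuantumFields.BalabanUV.Beta.RemainderExplicitHistoryDiagonalWeights

open Literature.MathematicalPhysics.QuantumFieldTheory.Balaban1983to89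
open Literature.MathematicalPhysics.QuantumFieldTheory.Balaban1983to89.FlowStep
open Literature.MathematicalPhysics.QuantumFieldTheory.Balaban1983to89.T4CouplingMatching
open Literature.MathematicalPhysics.QuantumFieldTheory.Balaban1983to89.T4OneLoopAsymptotics
open Summit.QuantumFields.BalabanUV.Beta.RemainderExplicitHistoryHalfMoment (mul_min_mono)

/-! ## §1 From recursion variables to couplings: order, the cubic conversion weight, two-sided gap bounds -/

/-- From inverse squares back to couplings: `0 < A`, `0 < B`, `1∕A² ≤ 1∕B²` ⇒ `B ≤ A`. [folklore] -/
theorem le_of_one_div_sq_le {A B : ℝ} (hA : 0 < A) (hB : 0 < B) (h : 1 / A ^ 2 ≤ 1 / B ^ 2) : B ≤ A := by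
  have h2 : B ^ 2 ≤ A ^ 2 := (one_div_le_one_div (pow_pos hA 2) (pow_pos hB 2)).mp h
  exact (pow_le_pow_iff_left₀ hB.le hA.le two_ne_zero).mp h2

/-- THE CONVERSION WEIGHT IS A CUBE: for `0 < B ≤ A`, `A − B ≤ (A³∕2)·(1∕B² − 1∕A²)` (`A − B = (1∕B² − 1∕A²)·A²B²∕(A + B)` and
`A²B²∕(A + B) ≤ A³∕2`). [folklore] -/
theorem gap_le_cube_mul {A B : ℝ} (hB : 0 < B) (hBA : B ≤ A) :
    A - B ≤ A ^ 3 / 2 * (1 / B ^ 2 - 1 / A ^ 2) := by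
  have hA : 0 < A := lt_of_lt_of_le hB hBA
  have hA0 : A ≠ 0 := hA.ne'
  have hB0 : B ≠ 0 := hB.ne'
  rw [show A ^ 3 / 2 * (1 / B ^ 2 - 1 / A ^ 2) = A * (A - B) * (A + B) / (2 * B ^ 2) by field_simp; ring,
    le_div_iff₀ (by positivity)]
  nlinarith [mul_nonneg (mul_nonneg (sub_nonneg.2 hBA) (sub_nonneg.2 hBA)) (by positivity : (0 : ℝ) ≤ A + 2 * B)]

/-- UPPER GAP BOUND WITH THE AGE: `0 < x' ≤ x`, `1∕x'² ≤ 1∕x² + L` (`L ≥ 0`) ⇒ `x − x' ≤ x·min(1, L·x²∕2)` — an older (more ultraviolet)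
coupling `x'` whose recursion variable exceeds that of `x` by at most `L` lies within `min(x, L·x³∕2)` of `x`. [folklore] -/
theorem gap_le_mul_min {x x' L : ℝ} (hx' : 0 < x') (hx'x : x' ≤ x) (hL : 0 ≤ L) (h : 1 / x' ^ 2 ≤ 1 / x ^ 2 + L) :
    x - x' ≤ x * min 1 (L * x ^ 2 / 2) := by
  have hx : 0 < x := lt_of_lt_of_le hx' hx'x
  have h1 : (x - x') * (x + x') ≤ L * x ^ 2 * x' ^ 2 := by
    have hx2 : 0 < x ^ 2 := pow_pos hx 2
    have hx'2 : 0 < x' ^ 2 := pow_pos hx' 2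
    have := mul_le_mul_of_nonneg_left h (mul_pos hx2 hx'2).le
    rw [mul_add, show x ^ 2 * x' ^ 2 * (1 / x' ^ 2) = x ^ 2 by field_simp,
      show x ^ 2 * x' ^ 2 * (1 / x ^ 2) = x' ^ 2 by field_simp] at this
    nlinarith
  rcases le_total 1 (L * x ^ 2 / 2) with hc | hc
  · rw [min_eq_left hc]; linarith
  · rw [min_eq_right hc]
    -- `(x − x')·2x' ≤ (x − x')(x + x') ≤ L x² x'² ≤ L x³ x'`
    have h2 : (x - x') * (2 * x') ≤ L * x ^ 3 * x' := by
      nlinarith [mul_nonneg (sub_nonneg.2 hx'x) hx'.le, mul_nonneg (mul_nonneg hL (pow_pos hx 2).le) (mul_nonneg hx'.le (sub_nonneg.2 hx'x))]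
    have h3 : x - x' ≤ L * x ^ 3 / 2 := by
      by_contra hcon
      rw [not_le] at hcon
      nlinarith
    nlinarith

/-- LOWER GAP BOUND WITH THE AGE: `0 < x'`, `0 < x`, `1∕x² + L ≤ 1∕x'²` (`L ≥ 0`) ⇒ `(x∕8)·min(1, L·x²) ≤ x − x'` — an older coupling whose
recursion variable exceeds that of `x` by at least `L` lies at least `min(x, L·x³)∕8` below `x`. [folklore] -/
theorem mul_min_le_gap {x x' L : ℝ} (hx' : 0 < x') (hx : 0 < x) (hL : 0 ≤ L) (h : 1 / x ^ 2 + L ≤ 1 / x' ^ 2) :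
    x / 8 * min 1 (L * x ^ 2) ≤ x - x' := by
  have h1 : x' ^ 2 * (1 + L * x ^ 2) ≤ x ^ 2 := by
    have hx2 : 0 < x ^ 2 := pow_pos hx 2
    have hx'2 : 0 < x' ^ 2 := pow_pos hx' 2
    have := mul_le_mul_of_nonneg_left h (mul_pos hx2 hx'2).le
    rw [mul_add, show x ^ 2 * x' ^ 2 * (1 / x' ^ 2) = x ^ 2 by field_simp,
      show x ^ 2 * x' ^ 2 * (1 / x ^ 2) = x' ^ 2 by field_simp] at this
    nlinarith
  have hx'x : x' ≤ x := by nlinarith [mul_nonneg (pow_pos hx' 2).le (mul_nonneg hL (pow_pos hx 2).le)]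
  have hmin1 : min 1 (L * x ^ 2) ≤ 1 := min_le_left _ _
  have hmin0 : 0 ≤ min 1 (L * x ^ 2) := le_min zero_le_one (by positivity)
  rcases le_total 1 (L * x ^ 2) with hc | hc
  · -- `2x'² ≤ x²` ⇒ `x' ≤ 7x∕8`
    rw [min_eq_left hc]
    have h2 : 2 * x' ^ 2 ≤ x ^ 2 := by nlinarith [mul_nonneg (pow_pos hx' 2).le (sub_nonneg.2 hc)]
    nlinarith
  · rw [min_eq_right hc]
    by_cases hhalf : x ≤ 2 * x'
    · -- `(x − x')·2x ≥ (x − x')(x + x') ≥ L x² x'² ≥ L x⁴∕4`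
      nlinarith [mul_nonneg (sub_nonneg.2 hx'x) (sub_nonneg.2 hhalf), mul_nonneg hL (pow_pos hx 2).le,
        mul_nonneg (mul_nonneg hL (pow_pos hx 2).le) (mul_nonneg hx'.le hx'.le)]
    · rw [not_le] at hhalf
      nlinarith [mul_nonneg hx.le (sub_nonneg.2 hc)]

/-! ## §2 The asymptotic-freedom weights of a box run with a floor -/

/-- On a box run with the floor `b ≤ β`: `(g_i)³ ≤ (1∕√a_{K−i})²·(1∕√a_{K−i})` with `a_m = 1∕γ² + b·m`
(`T4CouplingMatching.inv_sq_lower_of_betaLower` BY NAME). [cite: Balaban1987RG1, (0.31) p.259] -/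
theorem cube_le_weight {β : HBeta} {γ b : ℝ} {K : ℕ} {g : ℕ → ℝ} (hγ : 0 < γ) (hb : 0 < b) (h : RGEqH K β g)
    (hbox : ∀ i, i ≤ K → 0 < g i ∧ g i ≤ γ) (hlo : BetaLowerH b γ β) {i : ℕ} (hi : i ≤ K) :
    (g i) ^ 3 ≤ 1 / (sprof γ b (K - i)) ^ 2 * (1 / sprof γ b (K - i)) := by
  have hp0 := sprof_pos hγ hb.le (K - i)
  have hgi := hbox i hi
  have hgK := hbox K le_rfl
  have hK : 1 / γ ^ 2 ≤ 1 / (g K) ^ 2 :=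
    one_div_le_one_div_of_le (pow_pos hgK.1 2) (pow_le_pow_left₀ hgK.1.le hgK.2 2)
  have h1 := inv_sq_lower_of_betaLower h hbox hlo hi
  have ha : prof γ b (K - i) ≤ 1 / (g i) ^ 2 := by unfold prof; linarith
  have hsq : (g i) ^ 2 ≤ 1 / (sprof γ b (K - i)) ^ 2 := by
    rw [sprof_sq hγ hb.le, le_one_div (pow_pos hgi.1 2) (prof_pos hγ hb.le _)]
    exact ha
  have hsq' : (g i) ^ 2 ≤ (1 / sprof γ b (K - i)) ^ 2 := by rwa [one_div_pow]
  have h1' : g i ≤ 1 / sprof γ b (K - i) :=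
    (pow_le_pow_iff_left₀ hgi.1.le (one_div_pos.mpr hp0).le two_ne_zero).mp hsq'
  calc (g i) ^ 3 = (g i) ^ 2 * g i := by ring
    _ ≤ 1 / (sprof γ b (K - i)) ^ 2 * (1 / sprof γ b (K - i)) := mul_le_mul hsq h1' hgi.1.le (by positivity)

/-- THE ASYMPTOTIC-FREEDOM WEIGHTS SUM TO `2γ∕b`, UNIFORMLY IN THE CUTOFF: `Σ_{i<K} (1∕√a_{K−i})²·(1∕√a_{K−i}) ≤ 2γ∕b`
(`T4CouplingMatching.inv_cube_le_telescope` telescoped from `a_1` to `a_K`; the pin term `i = K` is absent). [cite: Balaban1987RG1, (0.31) p.259] -/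
theorem sum_weights_lt_le {γ b : ℝ} (hγ : 0 < γ) (hb : 0 < b) (K : ℕ) :
    ∑ i ∈ range K, 1 / (sprof γ b (K - i)) ^ 2 * (1 / sprof γ b (K - i)) ≤ 2 * γ / b := by
  have hp0 := sprof_pos hγ hb.le
  have hrefl : ∑ i ∈ range K, 1 / (sprof γ b (K - i)) ^ 2 * (1 / sprof γ b (K - i))
      = ∑ j ∈ range K, 1 / (sprof γ b (j + 1)) ^ 2 * (1 / sprof γ b (j + 1)) := by
    rw [← Finset.sum_range_reflect (fun j => 1 / (sprof γ b (j + 1)) ^ 2 * (1 / sprof γ b (j + 1))) K]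
    refine Finset.sum_congr rfl fun i hi => ?_
    have hi' := Finset.mem_range.mp hi
    rw [show K - 1 - i + 1 = K - i by omega]
  have hstep : ∀ j : ℕ, 1 / (sprof γ b (j + 1)) ^ 2 * (1 / sprof γ b (j + 1))
      ≤ 2 / b * (1 / sprof γ b j - 1 / sprof γ b (j + 1)) := fun j =>
    inv_cube_le_telescope (hp0 j) (sprof_mono hb.le j) hb (sprof_sq_diff hγ hb.le j)
  have hsK : 0 ≤ 1 / sprof γ b K := (one_div_pos.mpr (hp0 K)).le
  have h2b : 0 ≤ 2 / b := by positivity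
  calc ∑ i ∈ range K, 1 / (sprof γ b (K - i)) ^ 2 * (1 / sprof γ b (K - i))
      = ∑ j ∈ range K, 1 / (sprof γ b (j + 1)) ^ 2 * (1 / sprof γ b (j + 1)) := hrefl
    _ ≤ ∑ j ∈ range K, 2 / b * (1 / sprof γ b j - 1 / sprof γ b (j + 1)) := Finset.sum_le_sum fun j _ => hstep j
    _ = 2 / b * (1 / sprof γ b 0 - 1 / sprof γ b K) := by
        rw [← Finset.mul_sum, Finset.sum_range_sub' (fun j => 1 / sprof γ b j) K]
    _ ≤ 2 / b * (1 / sprof γ b 0) := mul_le_mul_of_nonneg_left (by linarith) h2b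
    _ = 2 * γ / b := by rw [sprof_zero hγ, one_div_one_div]; ring

/-! ## §3 Re-indexing the extra-history source by AGE, and the two window sums -/

/-- **POSITION-MAJOR TO AGE-MAJOR.**  For any `F : ℕ → ℕ → ℝ`,
`Σ_{j<K} Σ_{i<n} F (j+n−i) j = Σ_{a<K+n} Σ_{j<K, j+1 ≤ a ≤ j+n} F a j` — at position `j` the extra ages are `a = j + n − i ∈ [j+1, j+n]`.
[folklore] -/
theorem sum_extra_ages_swap (F : ℕ → ℕ → ℝ) (K n : ℕ) :
    ∑ j ∈ range K, ∑ i ∈ range n, F (j + n - i) j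
      = ∑ a ∈ range (K + n), ∑ j ∈ (range K).filter (fun j => j + 1 ≤ a ∧ a ≤ j + n), F a j := by
  classical
  have hinner : ∀ j ∈ range K, ∑ i ∈ range n, F (j + n - i) j
      = ∑ a ∈ range (K + n), if j + 1 ≤ a ∧ a ≤ j + n then F a j else 0 := by
    intro j hj
    have hjK := Finset.mem_range.mp hj
    have hset : (range (K + n)).filter (fun a => j + 1 ≤ a ∧ a ≤ j + n) = Ico (j + 1) (j + n + 1) := by
      ext a
      simp only [Finset.mem_filter, Finset.mem_range, Finset.mem_Ico]
      omega
    rw [← Finset.sum_filter, hset, Finset.sum_Ico_eq_sum_range, show j + n + 1 - (j + 1) = n by omega,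
      ← Finset.sum_range_reflect (fun i => F (j + n - i) j) n]
    refine Finset.sum_congr rfl fun i hi => ?_
    have hi' := Finset.mem_range.mp hi
    rw [show j + n - (n - 1 - i) = j + 1 + i by omega]
  rw [Finset.sum_congr rfl hinner, Finset.sum_comm]
  refine Finset.sum_congr rfl fun a _ => ?_
  rw [Finset.sum_filter]

/-- The positions carrying an extra age `a` are among the first `min(a, K)` ultraviolet positions … [folklore] -/
theorem filter_extra_subset (K n a : ℕ) :
    (range K).filter (fun j => j + 1 ≤ a ∧ a ≤ j + n) ⊆ range (min a K) := by
  intro j hj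
  simp only [Finset.mem_filter, Finset.mem_range] at hj
  simp only [Finset.mem_range, lt_min_iff]
  omega

/-- … and are exactly those when `a ≤ n`. [folklore] -/
theorem filter_extra_eq {K n a : ℕ} (ha : a ≤ n) :
    (range K).filter (fun j => j + 1 ≤ a ∧ a ≤ j + n) = range (min a K) := by
  ext j
  simp only [Finset.mem_filter, Finset.mem_range, lt_min_iff]
  omega

/-- `Σ_{j<K} 1∕√(b(K−j)) ≤ 2√K∕√b` (`T4OneLoopAsymptotics.sum_inv_sqrt_mul_succ_le` reflected). [folklore] -/
theorem sum_inv_sqrt_rev_le {b : ℝ} (hb : 0 < b) (K : ℕ) :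
    ∑ j ∈ range K, 1 / Real.sqrt (b * ((K - j : ℕ) : ℝ)) ≤ 2 * Real.sqrt K / Real.sqrt b := by
  have h := sum_inv_sqrt_mul_succ_le hb K
  rw [← Finset.sum_range_reflect (fun j : ℕ => 1 / Real.sqrt (b * ((j : ℝ) + 1))) K] at h
  refine le_trans (le_of_eq (Finset.sum_congr rfl fun j hj => ?_)) h
  have hj' := Finset.mem_range.mp hj
  rw [show ((K - j : ℕ) : ℝ) = ((K - 1 - j : ℕ) : ℝ) + 1 by push_cast [show K - j = K - 1 - j + 1 by omega]; ring]

/-- **THE UPPER WINDOW SUM.**  For `b > 0`, `κ ≥ 1`, `K ≥ 1` and an age `a`: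
`Σ_{j<min(a,K)} (1∕√(b(K−j)))·min(1, κa∕(2(K−j))) ≤ 8κ·min(a,K)²∕(K·√(bK))` — ages `a ≤ K∕2` sit at infrared distances `≥ K∕2`, where each of
their `a` terms is `≤ √2κa∕(K√(bK))`; ages `a > K∕2` pay the whole profile sum `2√K∕√b ≤ 8·min(a,K)²∕(K√(bK))`. [folklore] -/
theorem window_upper_le {b κ : ℝ} (hb : 0 < b) (hκ : 1 ≤ κ) {K : ℕ} (hK : 1 ≤ K) (a : ℕ) :
    ∑ j ∈ range (min a K), 1 / Real.sqrt (b * ((K - j : ℕ) : ℝ)) * min 1 (κ * a / (2 * ((K - j : ℕ) : ℝ)))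
      ≤ 8 * κ * (min (a : ℝ) K) ^ 2 / ((K : ℝ) * Real.sqrt (b * K)) := by
  have hKr : (1 : ℝ) ≤ K := by exact_mod_cast hK
  have hKpos : (0 : ℝ) < K := by linarith
  have hsbK : 0 < Real.sqrt (b * K) := Real.sqrt_pos.2 (by positivity)
  have hsb : 0 < Real.sqrt b := Real.sqrt_pos.2 hb
  have hsbK_eq : Real.sqrt (b * K) = Real.sqrt b * Real.sqrt K := Real.sqrt_mul hb.le _
  -- every term is nonnegative and at most the bare profile term
  have hterm0 : ∀ j ∈ range (min a K), 0 ≤ 1 / Real.sqrt (b * ((K - j : ℕ) : ℝ)) * min 1 (κ * a / (2 * ((K - j : ℕ) : ℝ))) := by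
    intro j _; exact mul_nonneg (by positivity) (le_min zero_le_one (by positivity))
  have hterm1 : ∀ j ∈ range (min a K), 1 / Real.sqrt (b * ((K - j : ℕ) : ℝ)) * min 1 (κ * a / (2 * ((K - j : ℕ) : ℝ)))
      ≤ 1 / Real.sqrt (b * ((K - j : ℕ) : ℝ)) := by
    intro j _; exact mul_le_of_le_one_right (by positivity) (min_le_left _ _)
  -- (F1) the whole-profile bound
  have hF1 : ∑ j ∈ range (min a K), 1 / Real.sqrt (b * ((K - j : ℕ) : ℝ)) * min 1 (κ * a / (2 * ((K - j : ℕ) : ℝ)))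
      ≤ 2 * Real.sqrt K / Real.sqrt b := by
    calc _ ≤ ∑ j ∈ range (min a K), 1 / Real.sqrt (b * ((K - j : ℕ) : ℝ)) := Finset.sum_le_sum hterm1
      _ ≤ ∑ j ∈ range K, 1 / Real.sqrt (b * ((K - j : ℕ) : ℝ)) :=
          Finset.sum_le_sum_of_subset_of_nonneg (Finset.range_mono (min_le_right a K)) fun j _ _ => by positivity
      _ ≤ 2 * Real.sqrt K / Real.sqrt b := sum_inv_sqrt_rev_le hb K
  by_cases h2a : 2 * a ≤ K
  · -- ages `a ≤ K∕2`: `min a K = a`, infrared distances `K − j ≥ K∕2`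
    have haK : min a K = a := min_eq_left (by omega)
    have hmin : min (a : ℝ) K = a := by rw [min_eq_left]; exact_mod_cast (by omega : a ≤ K)
    rw [haK, hmin]
    have hterm2 : ∀ j ∈ range a, 1 / Real.sqrt (b * ((K - j : ℕ) : ℝ)) * min 1 (κ * a / (2 * ((K - j : ℕ) : ℝ)))
        ≤ Real.sqrt 2 * κ * a / ((K : ℝ) * Real.sqrt (b * K)) := by
      intro j hj
      have hj' := Finset.mem_range.mp hj
      have hs : (K : ℝ) ≤ 2 * ((K - j : ℕ) : ℝ) := by
        rw [Nat.cast_sub (by omega)]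
        have : (2 : ℝ) * a ≤ K := by exact_mod_cast h2a
        have : (j : ℝ) < a := by exact_mod_cast hj'
        linarith
      have hs0 : (0 : ℝ) < ((K - j : ℕ) : ℝ) := by linarith
      -- `1∕√(bs) ≤ √2∕√(bK)` and `κa∕(2s) ≤ κa∕K`
      have h1 : 1 / Real.sqrt (b * ((K - j : ℕ) : ℝ)) ≤ Real.sqrt 2 / Real.sqrt (b * K) := by
        rw [div_le_div_iff₀ (Real.sqrt_pos.2 (by positivity)) hsbK, one_mul, ← Real.sqrt_mul (by norm_num : (0:ℝ) ≤ 2)]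
        exact Real.sqrt_le_sqrt (by nlinarith [hb])
      have h2 : min 1 (κ * a / (2 * ((K - j : ℕ) : ℝ))) ≤ κ * a / K :=
        (min_le_right _ _).trans (div_le_div_of_nonneg_left (by positivity) hKpos hs)
      calc 1 / Real.sqrt (b * ((K - j : ℕ) : ℝ)) * min 1 (κ * a / (2 * ((K - j : ℕ) : ℝ)))
          ≤ Real.sqrt 2 / Real.sqrt (b * K) * (κ * a / K) :=
            mul_le_mul h1 h2 (le_min zero_le_one (by positivity)) (by positivity)
        _ = Real.sqrt 2 * κ * a / ((K : ℝ) * Real.sqrt (b * K)) := by field_simp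
    calc ∑ j ∈ range a, 1 / Real.sqrt (b * ((K - j : ℕ) : ℝ)) * min 1 (κ * a / (2 * ((K - j : ℕ) : ℝ)))
        ≤ ∑ j ∈ range a, Real.sqrt 2 * κ * a / ((K : ℝ) * Real.sqrt (b * K)) := Finset.sum_le_sum hterm2
      _ = Real.sqrt 2 * κ * (a : ℝ) ^ 2 / ((K : ℝ) * Real.sqrt (b * K)) := by
          rw [Finset.sum_const, Finset.card_range, nsmul_eq_mul]; ring
      _ ≤ 8 * κ * (a : ℝ) ^ 2 / ((K : ℝ) * Real.sqrt (b * K)) := by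
          refine div_le_div_of_nonneg_right ?_ (by positivity)
          have hs2 : Real.sqrt 2 ≤ 2 := by
            rw [show (2:ℝ) = Real.sqrt 4 by rw [show (4:ℝ) = 2 ^ 2 by norm_num, Real.sqrt_sq (by norm_num)]]
            exact Real.sqrt_le_sqrt (by norm_num)
          nlinarith [mul_nonneg (mul_nonneg (by linarith : (0:ℝ) ≤ 8 - Real.sqrt 2) (by linarith : (0:ℝ) ≤ κ)) (sq_nonneg (a:ℝ))]
  · -- ages `a > K∕2`: the whole profile
    rw [not_le] at h2a
    refine hF1.trans ?_
    have hmin2 : (K : ℝ) ≤ 2 * min (a : ℝ) K := by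
      rcases le_total (a : ℝ) K with h | h
      · rw [min_eq_left h]; exact_mod_cast (by omega : K ≤ 2 * a)
      · rw [min_eq_right h]; linarith
    rw [div_le_div_iff₀ hsb (by positivity), hsbK_eq]
    have hsK : Real.sqrt K * Real.sqrt K = K := Real.mul_self_sqrt hKpos.le
    have hsK0 : 0 < Real.sqrt (K : ℝ) := Real.sqrt_pos.2 hKpos
    -- `2√K·(K·√b·√K) ≤ 8κ·min²·√b`, i.e. `2K² ≤ 8κ min²`
    have : 2 * Real.sqrt K * ((K : ℝ) * (Real.sqrt b * Real.sqrt K)) = 2 * (K : ℝ) ^ 2 * Real.sqrt b := by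
      calc 2 * Real.sqrt K * ((K : ℝ) * (Real.sqrt b * Real.sqrt K)) = 2 * K * Real.sqrt b * (Real.sqrt K * Real.sqrt K) := by ring
        _ = 2 * (K : ℝ) ^ 2 * Real.sqrt b := by rw [hsK]; ring
    rw [this]
    have hK2 : (K : ℝ) ^ 2 ≤ 4 * (min (a : ℝ) K) ^ 2 := by nlinarith [le_min (Nat.cast_nonneg a) hKpos.le]
    nlinarith [hsb.le, mul_nonneg hsb.le (sq_nonneg (min (a : ℝ) K))]

/-- **THE LOWER WINDOW SUM.**  For `b₂ > 0`, `κ₂ ≥ 1`, `K ≥ 1` and an age `a`: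
`min(a,K)²∕(κ₂·K·√(b₂K)) ≤ Σ_{j<min(a,K)} (1∕√(b₂(K−j)))·min(1, a∕(κ₂(K−j)))` — each of the `min(a,K)` terms is at least the one at
infrared distance `K`, which is `≥ (1∕√(b₂K))·min(a,K)∕(κ₂K)`. [folklore] -/
theorem le_window_lower {b₂ κ₂ : ℝ} (hb₂ : 0 < b₂) (hκ₂ : 1 ≤ κ₂) {K : ℕ} (hK : 1 ≤ K) (a : ℕ) :
    (min (a : ℝ) K) ^ 2 / (κ₂ * K * Real.sqrt (b₂ * K))
      ≤ ∑ j ∈ range (min a K), 1 / Real.sqrt (b₂ * ((K - j : ℕ) : ℝ)) * min 1 (a / (κ₂ * ((K - j : ℕ) : ℝ))) := by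
  have hKr : (1 : ℝ) ≤ K := by exact_mod_cast hK
  have hKpos : (0 : ℝ) < K := by linarith
  have hsbK : 0 < Real.sqrt (b₂ * K) := Real.sqrt_pos.2 (by positivity)
  have hmin_cast : ((min a K : ℕ) : ℝ) = min (a : ℝ) K := Nat.cast_min a K
  have hmin0 : 0 ≤ min (a : ℝ) K := le_min (Nat.cast_nonneg a) hKpos.le
  have hminK : min (a : ℝ) K ≤ K := min_le_right _ _
  have hmina : min (a : ℝ) K ≤ a := min_le_left _ _
  -- every term is at least the one at infrared distance `K`
  have hterm : ∀ j ∈ range (min a K), 1 / Real.sqrt (b₂ * K) * (min (a : ℝ) K / (κ₂ * K))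
      ≤ 1 / Real.sqrt (b₂ * ((K - j : ℕ) : ℝ)) * min 1 (a / (κ₂ * ((K - j : ℕ) : ℝ))) := by
    intro j hj
    have hj' : j < min a K := Finset.mem_range.mp hj
    have hs1 : (0 : ℝ) < ((K - j : ℕ) : ℝ) := by exact_mod_cast (by omega : 0 < K - j)
    have hsK : ((K - j : ℕ) : ℝ) ≤ K := by exact_mod_cast Nat.sub_le K j
    have h1 : 1 / Real.sqrt (b₂ * K) ≤ 1 / Real.sqrt (b₂ * ((K - j : ℕ) : ℝ)) :=
      one_div_le_one_div_of_le (Real.sqrt_pos.2 (by positivity)) (Real.sqrt_le_sqrt (by nlinarith))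
    have h2 : min (a : ℝ) K / (κ₂ * K) ≤ min 1 (a / (κ₂ * ((K - j : ℕ) : ℝ))) := by
      refine le_min ?_ ?_
      · rw [div_le_one (by positivity)]; nlinarith
      · exact div_le_div₀ (Nat.cast_nonneg a) hmina (by positivity) (by nlinarith)
    exact mul_le_mul h1 h2 (by positivity) (by positivity)
  calc (min (a : ℝ) K) ^ 2 / (κ₂ * K * Real.sqrt (b₂ * K))
      = ((min a K : ℕ) : ℝ) * (1 / Real.sqrt (b₂ * K) * (min (a : ℝ) K / (κ₂ * K))) := by
        rw [hmin_cast]; field_simp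
    _ = ∑ j ∈ range (min a K), 1 / Real.sqrt (b₂ * K) * (min (a : ℝ) K / (κ₂ * K)) := by
        rw [Finset.sum_const, Finset.card_range, nsmul_eq_mul]
    _ ≤ _ := Finset.sum_le_sum hterm

end Summit.QuantumFields.BalabanUV.Beta.RemainderExplicitHistoryDiagonalWeights

end
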